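import Literature.NumberTheory.LFunctions.SelbergClassDegreeBounds
import Literature.Analysis.Complex.RademacherPhragmenLindelof
import HarnessLib

/-!
# The Selberg class: polynomial growth in vertical strips (convexity bound)

General API for `Literature.NumberTheory.LFunctions.SelbergDatum` (Selberg's class `𝒮`), proved:

* `SelbergDatum.exists_norm_toFun_le_of_re_ge` — `F` is bounded on `re s ≥ 3/2`.
* `SelbergDatum.exists_norm_toFun_left_line_le` — **polynomial growth on far-left lines**: there is
  `κ₀` such that for `κ ≥ κ₀`, `‖F(1 − κ + it)‖ ≤ C_κ (1 + |t|)^{A_κ}`; from the functional equation in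
  the pole-free form `SelbergDatum.norm_toFun_eq_of_re_lt_one` and the uniform vertical Gamma-ratio
  bound `Literature.Analysis.SpecialFunctions.norm_Gamma_mul_norm_inv_Gamma_le` (the route of
  `SelbergClassDegreeBounds.lean`, which treats the lines `re s = −k − 1/2` for `d < 1`).
* `SelbergDatum.exists_norm_pow_mul_toFun_le` — **the convexity bound**: for all `σ₁ ≤ σ₂` there are
  `C, A` with `‖(s − 1)^m F(s)‖ ≤ C (1 + |im s|)^A` on `σ₁ ≤ re s ≤ σ₂` (`s ≠ 1`), by Rademacher's
  Phragmén–Lindelöf theorem (`Literature.Analysis.Complex.rademacher_phragmenLindelof_of_finiteOrder`)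
  applied to the entire finite-order function `(s − 1)^m F(s)` (axiom (ii)) on `[1 − κ, κ]`.

This is the standard fact that elements of `𝒮` have polynomial growth in vertical strips
(Conrey–Ghosh 1993, §2; it is what makes zero counting by Jensen's formula give `O(log T)` zeros per
unit height). It is used by the formalisation of Soundararajan's strong multiplicity one theorem
(`SelbergClassStrongMultiplicityOne.lean`), but is independent of it.

## References

* J. B. Conrey, A. Ghosh, *On the Selberg class of Dirichlet series: small degrees*, Duke Math. J.
  72 (1993), 673–693, §2. [ConreyGhosh1993]
* H. Rademacher, *On the Phragmén–Lindelöf theorem and some applications*, Math. Z. 72 (1959),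
  Theorem 2. [Rademacher1959]
-/

noncomputable section

open Complex Filter Topology Set Asymptotics Metric
open scoped ComplexConjugate

namespace Literature.NumberTheory.LFunctions

namespace SelbergDatum

open Literature.Analysis.SpecialFunctions Literature.Analysis.Complex

variable (D : SelbergDatum)

/-- `F` is bounded on `re s ≥ 3/2`: the constant `A₀ = ∑ |a(n)| n^{-3/2} + 1 > 0`. [folklore] -/
theorem exists_norm_toFun_le_of_re_ge :
    ∃ A₀ : ℝ, 0 < A₀ ∧ ∀ s : ℂ, 3 / 2 ≤ s.re → ‖D.toFun s‖ ≤ A₀ := by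
  refine ⟨(∑' n : ℕ, ‖LSeries.term D.coeff ((3 / 2 : ℝ) : ℂ) n‖) + 1, ?_, fun s hs ↦
    (D.norm_toFun_le_tsum s hs).trans (by linarith)⟩
  have : 0 ≤ ∑' n : ℕ, ‖LSeries.term D.coeff ((3 / 2 : ℝ) : ℂ) n‖ := tsum_nonneg fun n ↦ norm_nonneg _
  linarith

set_option maxHeartbeats 1000000 in
/-- **Polynomial growth of `F` on far-left vertical lines** (functional equation + the uniform
vertical Gamma-ratio bound `Literature.Analysis.SpecialFunctions.norm_Gamma_mul_norm_inv_Gamma_le`):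
there is `κ₀ ≥ 2` such that for every `κ ≥ κ₀`, `‖F(1 − κ + it)‖ ≤ C_κ (1 + |t|)^{A_κ}` for all real
`t`. (Stirling's formula would give `A_κ = d(κ − 1/2)`; any polynomial bound suffices here.)
[cite: ConreyGhosh1993, §2] -/
theorem exists_norm_toFun_left_line_le :
    ∃ κ₀ : ℝ, 2 ≤ κ₀ ∧ ∀ κ : ℝ, κ₀ ≤ κ → ∃ C A : ℝ, 0 < C ∧ 0 ≤ A ∧
      ∀ t : ℝ, ‖D.toFun (((1 - κ : ℝ) : ℂ) + t * I)‖ ≤ C * (1 + |t|) ^ A := by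
  obtain ⟨A₀, hA₀, hFA₀⟩ := D.exists_norm_toFun_le_of_re_ge
  -- `Sμ = ∑ ‖μⱼ‖` dominates every `‖μⱼ‖`
  obtain ⟨Sμ, hSμ⟩ : ∃ S : ℝ, ∑ j, ‖D.mu j‖ = S := ⟨_, rfl⟩
  have hSμ0 : 0 ≤ Sμ := by rw [← hSμ]; exact Finset.sum_nonneg fun j _ ↦ norm_nonneg _
  have hmuS : ∀ j, ‖D.mu j‖ ≤ Sμ := fun j ↦ by
    rw [← hSμ]
    exact Finset.single_le_sum (f := fun i ↦ ‖D.mu i‖) (fun i _ ↦ norm_nonneg _) (Finset.mem_univ j)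
  -- `κ₀`: large enough that `λⱼ (κ - 1) ≥ 1 + ‖μⱼ‖` for all `j`
  set κ₀ : ℝ := 2 + ∑ j, (1 + Sμ) / D.lam j with hκ₀
  have hκ₀2 : 2 ≤ κ₀ := by
    rw [hκ₀]
    have : 0 ≤ ∑ j, (1 + Sμ) / D.lam j :=
      Finset.sum_nonneg fun j _ ↦ div_nonneg (by linarith) (D.lam_pos j).le
    linarith
  refine ⟨κ₀, hκ₀2, fun κ hκ ↦ ?_⟩
  have hκ2 : 2 ≤ κ := hκ₀2.trans hκ
  have hkj : ∀ j, 1 + Sμ ≤ D.lam j * (κ - 1) := by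
    intro j
    have hl := D.lam_pos j
    have h1 : (1 + Sμ) / D.lam j ≤ ∑ i, (1 + Sμ) / D.lam i :=
      Finset.single_le_sum (f := fun i ↦ (1 + Sμ) / D.lam i)
        (fun i _ ↦ div_nonneg (by linarith) (D.lam_pos i).le) (Finset.mem_univ j)
    have h2 : (1 + Sμ) / D.lam j ≤ κ - 1 := by rw [hκ₀] at hκ; linarith
    rwa [div_le_iff₀ hl, mul_comm] at h2
  -- exponent and constant
  set Λ : ℝ := ∑ j, D.lam j with hΛ
  have hΛ0 : 0 ≤ Λ := Finset.sum_nonneg fun j _ ↦ (D.lam_pos j).le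
  set A : ℝ := ∑ j, (D.lam j * (2 * κ - 1) + 2) with hA
  have hA0 : 0 ≤ A := Finset.sum_nonneg fun j _ ↦ by nlinarith [D.lam_pos j]
  set β₀ : ℝ := 3 * Λ * κ + κ + 3 * Sμ + 4 with hβ₀
  have hΛκ0 : 0 ≤ Λ * κ := mul_nonneg hΛ0 (by linarith)
  have hβ₀1 : 1 ≤ β₀ := by rw [hβ₀]; nlinarith
  have hβ₀0 : 0 < β₀ := by linarith
  have hQ0 := D.Q_pos
  refine ⟨D.Q ^ (2 * κ - 1) * (120 * Real.pi ^ 2) ^ D.numGamma * β₀ ^ A * A₀, A,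
    by positivity, hA0, fun t ↦ ?_⟩
  set σ : ℝ := 1 - κ with hσ
  set s : ℂ := (σ : ℂ) + t * I with hs
  have hsre : s.re = σ := by simp [hs]
  have hsim : s.im = t := by simp [hs]
  have hs0 : s ≠ 0 := fun h ↦ by
    have := congrArg Complex.re h; rw [hsre, Complex.zero_re, hσ] at this; linarith
  have hs1 : s.re < 1 := by rw [hsre, hσ]; linarith
  rw [D.norm_toFun_eq_of_re_lt_one s hs0 hs1]
  -- (a) the power of `Q`
  have hQ : D.Q ^ (1 - 2 * s.re) = D.Q ^ (2 * κ - 1) := by rw [hsre, hσ]; ring_nf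
  -- (b) `‖F(1 - conj s)‖ ≤ A₀`
  have hF1 : ‖D.toFun (1 - conj s)‖ ≤ A₀ := hFA₀ _ (by simp [hsre, hσ]; linarith)
  -- (c) the Gamma ratios: `β = β₀ (1 + |t|)` dominates everything
  set β : ℝ := β₀ * (1 + |t|) with hβ
  have ht0 : 0 ≤ |t| := abs_nonneg t
  have hβ1 : 1 ≤ β := by rw [hβ]; nlinarith
  have hββ₀ : β₀ ≤ β := by rw [hβ]; nlinarith
  have hratio : ∀ j, ‖Gamma (D.lam j * (1 - s) + conj (D.mu j))‖ *
      ‖(Gamma (D.lam j * s + D.mu j))⁻¹‖ ≤ 120 * Real.pi ^ 2 * β ^ (D.lam j * (2 * κ - 1) + 2) := by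
    intro j
    have hl := D.lam_pos j
    have hμre := D.mu_re_nonneg j
    obtain ⟨X, hX⟩ : ∃ X : ℝ, D.lam j * κ + (D.mu j).re = X := ⟨_, rfl⟩
    obtain ⟨Y, hY⟩ : ∃ Y : ℝ, (D.mu j).re - D.lam j * (κ - 1) = Y := ⟨_, rfl⟩
    obtain ⟨u, hu⟩ : ∃ u : ℝ, D.lam j * t + (D.mu j).im = u := ⟨_, rfl⟩
    have hnum : (D.lam j : ℂ) * (1 - s) + conj (D.mu j) = conj ((X : ℂ) + u * I) := by
      apply Complex.ext
      · rw [re_lam_mul_add, Complex.sub_re, Complex.one_re, hsre, Complex.conj_re]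
        simp only [Complex.conj_re, Complex.add_re, Complex.ofReal_re, Complex.mul_re, Complex.I_re,
          Complex.ofReal_im, Complex.I_im, mul_zero, mul_one, sub_self, add_zero]
        rw [← hX, hσ]; ring
      · rw [im_lam_mul_add, Complex.sub_im, Complex.one_im, hsim, Complex.conj_im]
        simp only [Complex.conj_im, Complex.add_im, Complex.ofReal_im, Complex.mul_im, Complex.I_re,
          Complex.ofReal_re, Complex.I_im, mul_zero, mul_one, zero_add, add_zero]
        rw [← hu]; ring
    have hden : (D.lam j : ℂ) * s + D.mu j = (Y : ℂ) + u * I := by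
      apply Complex.ext
      · rw [re_lam_mul_add, hsre]
        simp only [Complex.add_re, Complex.ofReal_re, Complex.mul_re, Complex.I_re, Complex.ofReal_im,
          Complex.I_im, mul_zero, mul_one, sub_self, add_zero]
        rw [← hY, hσ]; ring
      · rw [im_lam_mul_add, hsim]
        simp only [Complex.add_im, Complex.ofReal_im, Complex.mul_im, Complex.I_re, Complex.ofReal_re,
          Complex.I_im, mul_zero, mul_one, zero_add, add_zero]
        rw [← hu]
    have hμ1 : |(D.mu j).im| ≤ ‖D.mu j‖ := Complex.abs_im_le_norm _
    have hμ2 : |(D.mu j).re| ≤ ‖D.mu j‖ := Complex.abs_re_le_norm _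
    have hμ3 := hmuS j
    have hX1 : 1 ≤ X := by
      rw [← hX]; nlinarith [hkj j, le_abs_self (D.mu j).re]
    have hY1 : Y ≤ 1 / 2 := by
      rw [← hY]; linarith [hkj j, le_abs_self (D.mu j).re, hμ2, hμ3]
    rw [hnum, Complex.Gamma_conj, Complex.norm_conj, hden]
    refine (norm_Gamma_mul_norm_inv_Gamma_le hX1 hY1 u).trans ?_
    have hu1 : |u| ≤ D.lam j * |t| + ‖D.mu j‖ := by
      rw [← hu]
      refine (abs_add_le _ _).trans ?_
      rw [abs_mul, abs_of_pos hl]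
      linarith
    have hlamΛ : D.lam j ≤ Λ :=
      Finset.single_le_sum (f := D.lam) (fun i _ ↦ (D.lam_pos i).le) (Finset.mem_univ j)
    have hlk : D.lam j * κ ≤ Λ * κ := mul_le_mul_of_nonneg_right hlamΛ (by linarith)
    have hlt : D.lam j * |t| ≤ Λ * κ * |t| :=
      mul_le_mul_of_nonneg_right (hlamΛ.trans (le_mul_of_one_le_right hΛ0 (by linarith))) ht0
    have hβexp : β = β₀ + β₀ * |t| := by rw [hβ]; ring
    have hβ₀Λ : Λ * κ ≤ β₀ := by rw [hβ₀]; linarith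
    have hΛt : Λ * κ * |t| ≤ β₀ * |t| := mul_le_mul_of_nonneg_right hβ₀Λ ht0
    have hb1 : 1 + |u| ≤ β := by rw [hβexp, hβ₀]; linarith
    have hXle : X ≤ Λ * κ + Sμ := by
      rw [← hX]; linarith [le_abs_self (D.mu j).re]
    have hYle : |Y| ≤ Λ * κ + Sμ := by
      rw [← hY, abs_le]; constructor
      · linarith [neg_abs_le (D.mu j).re]
      · linarith [le_abs_self (D.mu j).re]
    have hb2 : X + |Y| + 3 + |u| ≤ β := by rw [hβexp, hβ₀]; linarith
    have hexp : X - Y + 1 / 2 = D.lam j * (2 * κ - 1) + 1 / 2 := by rw [← hX, ← hY]; ring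
    rw [hexp]
    have hβ0 : 0 < β := by linarith
    have he0 : 0 ≤ D.lam j * (2 * κ - 1) + 1 / 2 := by nlinarith
    have hu0 : 0 ≤ 1 + |u| := by linarith [abs_nonneg u]
    have hv0 : 0 ≤ X + |Y| + 3 + |u| := by linarith [abs_nonneg Y, abs_nonneg u]
    have h1 : (1 + |u|) ^ (3 / 2 : ℝ) ≤ β ^ (3 / 2 : ℝ) := Real.rpow_le_rpow hu0 hb1 (by norm_num)
    have h2 : (X + |Y| + 3 + |u|) ^ (D.lam j * (2 * κ - 1) + 1 / 2) ≤
        β ^ (D.lam j * (2 * κ - 1) + 1 / 2) := Real.rpow_le_rpow hv0 hb2 he0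
    have hc0 : (0 : ℝ) ≤ 120 * Real.pi ^ 2 := by positivity
    have h3 : 120 * Real.pi ^ 2 * (1 + |u|) ^ (3 / 2 : ℝ) ≤ 120 * Real.pi ^ 2 * β ^ (3 / 2 : ℝ) :=
      mul_le_mul_of_nonneg_left h1 hc0
    have h4 : (0 : ℝ) ≤ 120 * Real.pi ^ 2 * β ^ (3 / 2 : ℝ) := mul_nonneg hc0 (Real.rpow_nonneg hβ0.le _)
    have h5 := mul_le_mul h3 h2 (Real.rpow_nonneg hv0 _) h4
    refine h5.trans_eq ?_
    rw [mul_assoc, ← Real.rpow_add hβ0]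
    congr 1; ring_nf
  have hprod : (∏ j, (‖Gamma (D.lam j * (1 - s) + conj (D.mu j))‖ *
      ‖(Gamma (D.lam j * s + D.mu j))⁻¹‖)) ≤ (120 * Real.pi ^ 2) ^ D.numGamma * β ^ A := by
    calc (∏ j, (‖Gamma (D.lam j * (1 - s) + conj (D.mu j))‖ * ‖(Gamma (D.lam j * s + D.mu j))⁻¹‖))
        ≤ ∏ j, (120 * Real.pi ^ 2 * β ^ (D.lam j * (2 * κ - 1) + 2)) :=
          Finset.prod_le_prod (fun j _ ↦ by positivity) (fun j _ ↦ hratio j)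
      _ = (120 * Real.pi ^ 2) ^ D.numGamma * β ^ A := by
          have hb0 : 0 < β := lt_of_lt_of_le one_pos hβ1
          have hpow : β ^ A = ∏ j, β ^ (D.lam j * (2 * κ - 1) + 2) := by
            rw [hA]; exact Real.rpow_sum_of_pos hb0 _ _
          rw [hpow, Finset.prod_mul_distrib, Finset.prod_const, Finset.card_univ, Fintype.card_fin]
  -- `β ^ A = β₀ ^ A (1 + |t|) ^ A`
  have hβA : β ^ A = β₀ ^ A * (1 + |t|) ^ A := by
    rw [hβ, Real.mul_rpow (by linarith) (by linarith)]
  rw [hQ]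
  have hP0 : 0 ≤ ∏ j, (‖Gamma (D.lam j * (1 - s) + conj (D.mu j))‖ * ‖(Gamma (D.lam j * s + D.mu j))⁻¹‖) :=
    Finset.prod_nonneg fun j _ ↦ by positivity
  have hQ0' : 0 ≤ D.Q ^ (2 * κ - 1) := Real.rpow_nonneg D.Q_pos.le _
  have step1 : D.Q ^ (2 * κ - 1) *
      (∏ j, (‖Gamma (D.lam j * (1 - s) + conj (D.mu j))‖ * ‖(Gamma (D.lam j * s + D.mu j))⁻¹‖)) *
      ‖D.toFun (1 - conj s)‖ ≤
      D.Q ^ (2 * κ - 1) * ((120 * Real.pi ^ 2) ^ D.numGamma * β ^ A) * A₀ :=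
    mul_le_mul (mul_le_mul_of_nonneg_left hprod hQ0') hF1 (norm_nonneg _)
      (mul_nonneg hQ0' (by positivity))
  refine step1.trans_eq ?_
  rw [hβA]; ring


/-- `‖z‖^B ≤ |im z|^{B'+1}` far up a vertical strip: if `|re z| ≤ κ` (`κ ≥ 1`), `B ≤ B'`, `1 ≤ B'`
and `|im z| ≥ max κ 2^{B'}`, then `‖z‖ ^ B ≤ |im z| ^ (B' + 1)`. [folklore] -/
theorem norm_rpow_le_abs_im_rpow {z : ℂ} {κ B B' : ℝ} (hκ : 1 ≤ κ) (hre : |z.re| ≤ κ) (hBB' : B ≤ B')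
    (hB' : 1 ≤ B') (him : max κ ((2 : ℝ) ^ B') ≤ |z.im|) : ‖z‖ ^ B ≤ |z.im| ^ (B' + 1) := by
  set y : ℝ := |z.im| with hy
  have hyκ : κ ≤ y := (le_max_left _ _).trans him
  have hy2 : (2 : ℝ) ^ B' ≤ y := (le_max_right _ _).trans him
  have hy1 : 1 ≤ y := hκ.trans hyκ
  have hy0 : 0 < y := by linarith
  have hz1 : 1 ≤ ‖z‖ := hy1.trans (by rw [hy]; exact Complex.abs_im_le_norm z)
  have hz2 : ‖z‖ ≤ 2 * y := by
    calc ‖z‖ ≤ |z.re| + |z.im| := Complex.norm_le_abs_re_add_abs_im z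
      _ ≤ κ + y := by rw [hy]; linarith
      _ ≤ 2 * y := by linarith
  calc ‖z‖ ^ B ≤ ‖z‖ ^ B' := Real.rpow_le_rpow_of_exponent_le hz1 hBB'
    _ ≤ (2 * y) ^ B' := Real.rpow_le_rpow (norm_nonneg _) hz2 (by linarith)
    _ = (2 : ℝ) ^ B' * y ^ B' := Real.mul_rpow zero_le_two hy0.le
    _ ≤ y * y ^ B' := mul_le_mul_of_nonneg_right hy2 (Real.rpow_nonneg hy0.le _)
    _ = y ^ (B' + 1) := by rw [Real.rpow_add hy0, Real.rpow_one, mul_comm]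

set_option maxHeartbeats 1000000 in
/-- **The convexity bound: polynomial growth of `(s − 1)^m F(s)` in every vertical strip.** For
every `σ₁ ≤ σ₂` there are `C > 0`, `A ≥ 0` with `‖(s−1)^m F(s)‖ ≤ C (1 + |im s|)^A` whenever
`σ₁ ≤ re s ≤ σ₂`, `s ≠ 1`: the Phragmén–Lindelöf principle in Rademacher's form
(`Literature.Analysis.Complex.rademacher_phragmenLindelof_of_finiteOrder`) applied to the entire
function `(s−1)^m F(s)` of finite order (axiom (ii)) on a wide strip `[1 − κ, κ]`, bounded
polynomially on the right edge by absolute convergence and on the left edge by the functional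
equation (`exists_norm_toFun_left_line_le`). This is the standard "polynomial growth in vertical
strips" of elements of `𝒮` (Conrey–Ghosh 1993, §2; Kaczorowski–Perelli survey, §2).
[cite: ConreyGhosh1993, §2] -/
theorem exists_norm_pow_mul_toFun_le (σ₁ σ₂ : ℝ) :
    ∃ C A : ℝ, 0 < C ∧ 0 ≤ A ∧ ∀ s : ℂ, σ₁ ≤ s.re → s.re ≤ σ₂ → s ≠ 1 →
      ‖(s - 1) ^ D.polarOrder * D.toFun s‖ ≤ C * (1 + |s.im|) ^ A := by
  obtain ⟨κ₀, hκ₀2, hline⟩ := D.exists_norm_toFun_left_line_le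
  obtain ⟨κ, hκκ₀, hκ3, hσ₁, hσ₂⟩ : ∃ κ : ℝ, κ₀ ≤ κ ∧ 3 ≤ κ ∧ 1 - κ ≤ σ₁ ∧ σ₂ ≤ κ := by
    refine ⟨max κ₀ (max (1 - σ₁) σ₂) + 1, ?_, ?_, ?_, ?_⟩
    · linarith [le_max_left κ₀ (max (1 - σ₁) σ₂)]
    · linarith [le_max_left κ₀ (max (1 - σ₁) σ₂)]
    · linarith [le_max_left (1 - σ₁) σ₂, le_max_right κ₀ (max (1 - σ₁) σ₂)]
    · linarith [le_max_right (1 - σ₁) σ₂, le_max_right κ₀ (max (1 - σ₁) σ₂)]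
  obtain ⟨C₁, A₁, hC₁, hA₁, hleft⟩ := hline κ hκκ₀
  obtain ⟨A₀, hA₀, hright⟩ := D.exists_norm_toFun_le_of_re_ge
  obtain ⟨G, hG, hGF⟩ := D.differentiable
  obtain ⟨Af, Bf, hfin⟩ := D.finiteOrder
  have hab : 1 - κ < κ := by linarith
  -- `‖κ + z‖ ≥ 1` and `|z - 1| ≤ (κ+2) ‖κ + z‖` on the closed strip
  have hQz : ∀ z : ℂ, 1 - κ ≤ z.re → 1 ≤ ‖(κ : ℂ) + z‖ := fun z hz ↦ by
    have : ((κ : ℂ) + z).re = κ + z.re := by simp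
    calc (1 : ℝ) ≤ κ + z.re := by linarith
      _ = |((κ : ℂ) + z).re| := by rw [this, abs_of_nonneg (by linarith)]
      _ ≤ ‖(κ : ℂ) + z‖ := Complex.abs_re_le_norm _
  have hz1 : ∀ z : ℂ, 1 - κ ≤ z.re → ‖z - 1‖ ≤ (κ + 2) * ‖(κ : ℂ) + z‖ := fun z hz ↦ by
    have h1 := hQz z hz
    have hk1 : ‖((κ : ℂ) + 1 : ℂ)‖ = κ + 1 := by
      rw [show ((κ : ℂ) + 1 : ℂ) = ((κ + 1 : ℝ) : ℂ) by push_cast; ring, Complex.norm_real,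
        Real.norm_of_nonneg (by linarith)]
    calc ‖z - 1‖ = ‖((κ : ℂ) + z) - ((κ : ℂ) + 1)‖ := by ring_nf
      _ ≤ ‖(κ : ℂ) + z‖ + ‖((κ : ℂ) + 1 : ℂ)‖ := norm_sub_le _ _
      _ = ‖(κ : ℂ) + z‖ + (κ + 1) := by rw [hk1]
      _ ≤ (κ + 2) * ‖(κ : ℂ) + z‖ := by nlinarith
  -- (1) left edge
  have hleft' : ∀ z : ℂ, z.re = 1 - κ →
      ‖G z‖ ≤ (C₁ * 2 ^ A₁ * (κ + 2) ^ D.polarOrder) * ‖(κ : ℂ) + z‖ ^ ((D.polarOrder : ℝ) + A₁) := by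
    intro z hz
    have hzne : z ≠ 1 := by
      intro h; rw [h, Complex.one_re] at hz; linarith
    have hzeq : z = ((1 - κ : ℝ) : ℂ) + z.im * I := by
      apply Complex.ext <;> simp [hz]
    have hF : ‖D.toFun z‖ ≤ C₁ * (1 + |z.im|) ^ A₁ := by
      have := hleft z.im; rwa [← hzeq] at this
    have hQ1 := hQz z hz.ge
    have hQ0 : 0 < ‖(κ : ℂ) + z‖ := by linarith
    have ht : 1 + |z.im| ≤ 2 * ‖(κ : ℂ) + z‖ := by
      have : |z.im| ≤ ‖(κ : ℂ) + z‖ := by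
        have := Complex.abs_im_le_norm ((κ : ℂ) + z); simpa using this
      linarith
    rw [hGF z hzne, norm_mul, norm_pow]
    calc ‖z - 1‖ ^ D.polarOrder * ‖D.toFun z‖
        ≤ ((κ + 2) * ‖(κ : ℂ) + z‖) ^ D.polarOrder * (C₁ * (1 + |z.im|) ^ A₁) := by
          gcongr
          exact hz1 z hz.ge
      _ ≤ ((κ + 2) * ‖(κ : ℂ) + z‖) ^ D.polarOrder * (C₁ * (2 * ‖(κ : ℂ) + z‖) ^ A₁) := by
          gcongr
      _ = (C₁ * 2 ^ A₁ * (κ + 2) ^ D.polarOrder) *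
            (‖(κ : ℂ) + z‖ ^ (D.polarOrder : ℝ) * ‖(κ : ℂ) + z‖ ^ A₁) := by
          rw [mul_pow, Real.mul_rpow zero_le_two hQ0.le, Real.rpow_natCast]; ring
      _ = (C₁ * 2 ^ A₁ * (κ + 2) ^ D.polarOrder) * ‖(κ : ℂ) + z‖ ^ ((D.polarOrder : ℝ) + A₁) := by
          rw [← Real.rpow_add hQ0]
  -- (2) right edge
  have hright' : ∀ z : ℂ, z.re = κ →
      ‖G z‖ ≤ (A₀ * (κ + 2) ^ D.polarOrder) * ‖(κ : ℂ) + z‖ ^ (D.polarOrder : ℝ) := by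
    intro z hz
    have hzne : z ≠ 1 := by
      intro h; rw [h, Complex.one_re] at hz; linarith
    have hF : ‖D.toFun z‖ ≤ A₀ := hright z (by rw [hz]; linarith)
    rw [hGF z hzne, norm_mul, norm_pow, Real.rpow_natCast]
    calc ‖z - 1‖ ^ D.polarOrder * ‖D.toFun z‖ ≤ ((κ + 2) * ‖(κ : ℂ) + z‖) ^ D.polarOrder * A₀ := by
          gcongr
          exact hz1 z (by rw [hz]; linarith)
      _ = (A₀ * (κ + 2) ^ D.polarOrder) * ‖(κ : ℂ) + z‖ ^ D.polarOrder := by rw [mul_pow]; ring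
  -- (3) finite order inside the strip
  have hK : IsCompact (Icc (-κ) κ ×ℂ Icc (-(max κ ((2 : ℝ) ^ (max Bf 1)))) (max κ ((2 : ℝ) ^ (max Bf 1)))) :=
    isCompact_Icc.reProdIm isCompact_Icc
  obtain ⟨M₁, hM₁⟩ := hK.exists_bound_of_continuousOn hG.continuous.continuousOn
  have hgr : ∀ z : ℂ, 1 - κ < z.re → z.re < κ →
      ‖G z‖ ≤ (|M₁| + |Af| + 1) * Real.exp (|z.im| ^ (max Bf 1 + 1)) := by
    intro z hza hzb
    have hre : |z.re| ≤ κ := abs_le.mpr ⟨by linarith, by linarith⟩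
    have hexp1 : 1 ≤ Real.exp (|z.im| ^ (max Bf 1 + 1)) :=
      Real.one_le_exp (Real.rpow_nonneg (abs_nonneg _) _)
    rcases le_or_gt |z.im| (max κ ((2 : ℝ) ^ (max Bf 1))) with hsmall | hlarge
    · -- in the compact box
      have hmem : z ∈ Icc (-κ) κ ×ℂ Icc (-(max κ ((2 : ℝ) ^ (max Bf 1)))) (max κ ((2 : ℝ) ^ (max Bf 1))) :=
        ⟨abs_le.mp hre, abs_le.mp hsmall⟩
      calc ‖G z‖ ≤ M₁ := hM₁ z hmem
        _ ≤ (|M₁| + |Af| + 1) * 1 := by linarith [le_abs_self M₁, abs_nonneg Af]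
        _ ≤ (|M₁| + |Af| + 1) * Real.exp (|z.im| ^ (max Bf 1 + 1)) :=
            mul_le_mul_of_nonneg_left hexp1 (by positivity)
    · -- far up: finite order, `‖z‖^Bf ≤ |im z|^(B'+1)`
      have hzne : z ≠ 1 := by
        intro h; rw [h, Complex.one_im, abs_zero] at hlarge
        linarith [le_max_left κ ((2 : ℝ) ^ (max Bf 1))]
      have hpow := norm_rpow_le_abs_im_rpow (B := Bf) (by linarith) hre (le_max_left _ _)
        (le_max_right _ _) hlarge.le
      calc ‖G z‖ = ‖(z - 1) ^ D.polarOrder * D.toFun z‖ := by rw [hGF z hzne]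
        _ ≤ Af * Real.exp (‖z‖ ^ Bf) := hfin z hzne
        _ ≤ |Af| * Real.exp (‖z‖ ^ Bf) :=
            mul_le_mul_of_nonneg_right (le_abs_self Af) (Real.exp_pos _).le
        _ ≤ |Af| * Real.exp (|z.im| ^ (max Bf 1 + 1)) :=
            mul_le_mul_of_nonneg_left (Real.exp_le_exp.mpr hpow) (abs_nonneg Af)
        _ ≤ (|M₁| + |Af| + 1) * Real.exp (|z.im| ^ (max Bf 1 + 1)) := by
            apply mul_le_mul_of_nonneg_right _ (Real.exp_pos _).le
            linarith [abs_nonneg M₁]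
  -- Rademacher
  have hAℓ0 : 0 < C₁ * 2 ^ A₁ * (κ + 2) ^ D.polarOrder := by positivity
  have hBr0 : 0 < A₀ * (κ + 2) ^ D.polarOrder := by positivity
  have hRad := fun (z : ℂ) (hza : 1 - κ ≤ z.re) (hzb : z.re ≤ κ) ↦
    rademacher_phragmenLindelof_of_finiteOrder (f := G) (Q := κ) hab (by linarith) hAℓ0 hBr0
      (by linarith : (D.polarOrder : ℝ) ≤ (D.polarOrder : ℝ) + A₁) hG.diffContOnCl
      (by linarith [le_max_right Bf 1] : (0 : ℝ) < max Bf 1 + 1) hgr hleft' hright' hza hzb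
  -- the constant
  set M' : ℝ := max (C₁ * 2 ^ A₁ * (κ + 2) ^ D.polarOrder) (A₀ * (κ + 2) ^ D.polarOrder) with hM'
  set α : ℝ := (D.polarOrder : ℝ) + A₁ with hα
  have hM'0 : 0 < M' := lt_max_of_lt_left hAℓ0
  have hα0 : 0 ≤ α := by rw [hα]; positivity
  refine ⟨M' * (2 * κ) ^ α, α, by positivity, hα0, fun s hs₁ hs₂ hs1 ↦ ?_⟩
  have hsa : 1 - κ ≤ s.re := hσ₁.trans hs₁
  have hsb : s.re ≤ κ := hs₂.trans hσ₂
  have h := hRad s hsa hsb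
  have hQ1 := hQz s hsa
  have hQ0 : 0 < ‖(κ : ℂ) + s‖ := by linarith
  -- both factors are at most `M' ‖κ+s‖^α`
  have hθ0 : 0 ≤ (κ - s.re) / (κ - (1 - κ)) := div_nonneg (by linarith) (by linarith)
  have hθ1 : 0 ≤ (s.re - (1 - κ)) / (κ - (1 - κ)) := div_nonneg (by linarith) (by linarith)
  have hθsum : (κ - s.re) / (κ - (1 - κ)) + (s.re - (1 - κ)) / (κ - (1 - κ)) = 1 := by
    rw [← add_div, div_eq_one_iff_eq (by linarith)]; ring
  have hX : C₁ * 2 ^ A₁ * (κ + 2) ^ D.polarOrder * ‖(κ : ℂ) + s‖ ^ α ≤ M' * ‖(κ : ℂ) + s‖ ^ α :=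
    mul_le_mul_of_nonneg_right (le_max_left _ _) (Real.rpow_nonneg hQ0.le _)
  have hY : A₀ * (κ + 2) ^ D.polarOrder * ‖(κ : ℂ) + s‖ ^ (D.polarOrder : ℝ) ≤ M' * ‖(κ : ℂ) + s‖ ^ α :=
    mul_le_mul (le_max_right _ _) (Real.rpow_le_rpow_of_exponent_le hQ1 (by rw [hα]; linarith))
      (Real.rpow_nonneg hQ0.le _) hM'0.le
  have hMQ : 0 < M' * ‖(κ : ℂ) + s‖ ^ α := mul_pos hM'0 (Real.rpow_pos_of_pos hQ0 _)
  have hprod : (C₁ * 2 ^ A₁ * (κ + 2) ^ D.polarOrder * ‖(κ : ℂ) + s‖ ^ α) ^ ((κ - s.re) / (κ - (1 - κ))) *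
      (A₀ * (κ + 2) ^ D.polarOrder * ‖(κ : ℂ) + s‖ ^ (D.polarOrder : ℝ)) ^ ((s.re - (1 - κ)) / (κ - (1 - κ)))
        ≤ M' * ‖(κ : ℂ) + s‖ ^ α := by
    have h1 := Real.rpow_le_rpow (by positivity) hX hθ0
    have h2 := Real.rpow_le_rpow (by positivity) hY hθ1
    refine (mul_le_mul h1 h2 (Real.rpow_nonneg (by positivity) _) (Real.rpow_nonneg hMQ.le _)).trans_eq ?_
    rw [← Real.rpow_add hMQ, hθsum, Real.rpow_one]
  -- `‖κ + s‖ ≤ 2κ (1 + |im s|)`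
  have hQle : ‖(κ : ℂ) + s‖ ≤ 2 * κ * (1 + |s.im|) := by
    have hre : ((κ : ℂ) + s).re = κ + s.re := by simp
    have him : ((κ : ℂ) + s).im = s.im := by simp
    calc ‖(κ : ℂ) + s‖ ≤ |((κ : ℂ) + s).re| + |((κ : ℂ) + s).im| := Complex.norm_le_abs_re_add_abs_im _
      _ = |κ + s.re| + |s.im| := by rw [hre, him]
      _ ≤ 2 * κ + |s.im| := by rw [abs_of_nonneg (by linarith)]; linarith
      _ ≤ 2 * κ * (1 + |s.im|) := by nlinarith [abs_nonneg s.im]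
  rw [← hGF s hs1]
  calc ‖G s‖ ≤ _ := h
    _ ≤ M' * ‖(κ : ℂ) + s‖ ^ α := hprod
    _ ≤ M' * (2 * κ * (1 + |s.im|)) ^ α :=
        mul_le_mul_of_nonneg_left (Real.rpow_le_rpow hQ0.le hQle hα0) hM'0.le
    _ = M' * (2 * κ) ^ α * (1 + |s.im|) ^ α := by
        rw [Real.mul_rpow (by linarith) (by linarith [abs_nonneg s.im])]; ring

end SelbergDatum
end Literature.NumberTheory.LFunctions

end
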